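import Literature.RingTheory.MvPolynomial.HypersurfaceFlecnodalLine
import Mathlib.RingTheory.PrincipalIdealDomain
import HarnessLib

/-!
# The three cases of Monge's theorem at the generic point

Topic `Literature/RingTheory/MvPolynomial`. Everything in this file is PROVED. With the notation
of `HypersurfaceAsymptoticLine.lean` (`L = K(S)`, `p̄ = D₀z̄`, `q̄ = D₁z̄`, `r = D₀p̄`,
`s = D₁p̄ = D₀q̄`, `t = D₁q̄`; `T₂ = r + 2sσ + tσ²`), the generic point of the surface carries
a line in each of the following cases [Kollar2015, Thm. 13, §6]:

* `Hypersurface.aeval_line_eq_zero_of_t_eq_zero` — `t = 0`: direction `(0, 1, q̄)`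
  (`Δ = D₁`);
* `Hypersurface.aeval_line_eq_zero_of_developable` — `t ≠ 0`, `s² = rt` (parabolic everywhere,
  i.e. developable): direction `(1, σ₀, p̄ + σ₀q̄)` with `tσ₀ = -s` (`Δ = D₀ + σ₀D₁`; the
  identity `Δσ₀ = 0` is the classical "a developable is ruled" computation);
* `Hypersurface.exists_flecnodal_line` — `t ≠ 0`, `s² ≠ rt`, `T₂, T₃` not coprime (flecnodal
  everywhere): direction `(1, σ, p̄ + σq̄)` over `L[σ]/(q)`, `q` an irreducible common factor
  (`T₂` is separable when `s² ≠ rt` and `2 ≠ 0`, so `q` is separable and `q ∤ T₂'`).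

## References
* [Kollar2015] J. Kollár, *Szemerédi–Trotter-type theorems in dimension 3*, Adv. Math. 271
  (2015), Theorem 13 and §6.
-/

namespace Literature.RingTheory.MvPolynomial

open Polynomial
open scoped Nat

/-! ### A monic irreducible common factor of two non-coprime polynomials -/

section CommonFactor

variable {L : Type*} [Field L]

/-- Two polynomials over a field that are not coprime (the first non-zero) have a monic
irreducible common factor. [folklore] -/
theorem exists_monic_irreducible_dvd_of_not_isCoprime {P Q : L[X]} (hP : P ≠ 0)
    (h : ¬ IsCoprime P Q) : ∃ q : L[X], q.Monic ∧ Irreducible q ∧ q ∣ P ∧ q ∣ Q := by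
  by_contra hne
  push Not at hne
  refine h (isCoprime_of_irreducible_dvd (fun h0 => hP h0.1) fun z hz hzP hzQ => ?_)
  have hz0 : z ≠ 0 := hz.ne_zero
  have hu : IsUnit (C (z.leadingCoeff)⁻¹) :=
    isUnit_C.2 (inv_ne_zero (leadingCoeff_ne_zero.2 hz0)).isUnit
  exact hne (z * C (z.leadingCoeff)⁻¹) (monic_mul_leadingCoeff_inv hz0)
    ((irreducible_mul_isUnit hu).2 hz) (hu.mul_right_dvd.2 hzP) (hu.mul_right_dvd.2 hzQ)

/-- A separable polynomial and an irreducible factor: the factor does not divide the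
derivative. [folklore] -/
theorem not_dvd_derivative_of_separable {P q : L[X]} (hq : Irreducible q) (hqP : q ∣ P)
    (hsep : P.Separable) : ¬ q ∣ derivative P := by
  intro hd
  obtain ⟨u, v, h⟩ := hsep
  refine hq.not_isUnit (isUnit_of_dvd_one ?_)
  rw [← h]
  exact dvd_add (dvd_mul_of_dvd_right hqP _) (dvd_mul_of_dvd_right hd _)

/-- A quadratic `r + 2sX + tX²` with `s² ≠ rt` (and `2 ≠ 0`) is separable:
`(-4t)·T + T'·T' = 4(s² - rt)`. [folklore] -/
theorem separable_quadratic {r s t : L} (h2 : (2 : L) ≠ 0) (hD : s ^ 2 - r * t ≠ 0) :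
    (C r + C (2 * s) * X + C t * X ^ 2).Separable := by
  have h4D : 4 * (s ^ 2 - r * t) ≠ 0 := by
    refine mul_ne_zero ?_ hD
    have : (4 : L) = 2 * 2 := by norm_num
    rw [this]
    exact mul_ne_zero h2 h2
  have hder : derivative (C r + C (2 * s) * X + C t * X ^ 2) = C (2 * s) + C (2 * t) * X := by
    rw [derivative_add, derivative_add, derivative_C, derivative_C_mul_X, derivative_C_mul_X_pow,
      zero_add, mul_comm t]
    norm_num
  have hid : C (-4 * t) * (C r + C (2 * s) * X + C t * X ^ 2) +
      (C (2 * s) + C (2 * t) * X) * (C (2 * s) + C (2 * t) * X) = C (4 * (s ^ 2 - r * t)) := by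
    simp only [map_mul, map_sub, map_neg, map_ofNat, map_pow]
    ring
  refine ⟨C ((4 * (s ^ 2 - r * t))⁻¹ * (-4 * t)),
    C ((4 * (s ^ 2 - r * t))⁻¹) * (C (2 * s) + C (2 * t) * X), ?_⟩
  rw [hder]
  calc C ((4 * (s ^ 2 - r * t))⁻¹ * (-4 * t)) * (C r + C (2 * s) * X + C t * X ^ 2) +
        C ((4 * (s ^ 2 - r * t))⁻¹) * (C (2 * s) + C (2 * t) * X) * (C (2 * s) + C (2 * t) * X)
      = C ((4 * (s ^ 2 - r * t))⁻¹) * (C (-4 * t) * (C r + C (2 * s) * X + C t * X ^ 2) +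
          (C (2 * s) + C (2 * t) * X) * (C (2 * s) + C (2 * t) * X)) := by
        rw [map_mul]
        ring
    _ = 1 := by rw [hid, ← map_mul, inv_mul_cancel₀ h4D, map_one]

end CommonFactor

namespace Hypersurface

variable {K : Type*} [Field K] {f : MvPolynomial (Fin 3) K} [Fact (Irreducible f)]

/-! ### Case `t = 0` -/

/-- **Case `t = 0`.** If `t = D₁q̄ = 0` the line through the generic point with direction
`(0, 1, q̄)` lies on the surface. [cite: Kollar2015, Theorem 13 and §6] -/
theorem aeval_line_eq_zero_of_t_eq_zero (h2 : toFn f (MvPolynomial.pderiv 2 f) ≠ 0)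
    (hfac : ∀ k, k ≤ f.totalDegree → ((k ! : ℕ) : K) ≠ 0)
    (ht : gD f 1 (gD f 1 (toFn f (MvPolynomial.X 2))) = 0) :
    MvPolynomial.aeval (fun i => C (toFn f (MvPolynomial.X i)) +
      C (![(0 : FnField f), 1, gD f 1 (toFn f (MvPolynomial.X 2))] i) * X) f = 0 := by
  have key := aeval_line_eq_zero_of_II_eq_zero (L' := FnField f) h2 hfac (gD f 1) 0 1
    (map_zero _) (Derivation.map_one_eq_zero _)
    (fun u => by simp only [Algebra.algebraMap_self, RingHom.id_apply]; ring)
    (by simp only [Algebra.algebraMap_self, RingHom.id_apply, ht]; ring)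
  simp only [Algebra.algebraMap_self, RingHom.id_apply, zero_mul, one_mul, zero_add] at key
  exact key

/-! ### Case `t ≠ 0`, `s² = rt` (developable) -/

/-- **The parabolic direction of a developable surface is constant along itself.** If `t ≠ 0`,
`s² = rt` and `tσ₀ = -s`, then `(D₀ + σ₀D₁)σ₀ = 0`. [folklore] -/
theorem slope_const_of_developable (h2 : toFn f (MvPolynomial.pderiv 2 f) ≠ 0)
    (ht : gD f 1 (gD f 1 (toFn f (MvPolynomial.X 2))) ≠ 0)
    (hdisc : gD f 1 (gD f 0 (toFn f (MvPolynomial.X 2))) ^ 2 -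
      gD f 0 (gD f 0 (toFn f (MvPolynomial.X 2))) * gD f 1 (gD f 1 (toFn f (MvPolynomial.X 2)))
        = 0)
    (σ₀ : FnField f) (hσ : σ₀ * gD f 1 (gD f 1 (toFn f (MvPolynomial.X 2))) =
      -gD f 1 (gD f 0 (toFn f (MvPolynomial.X 2)))) :
    gD f 0 σ₀ + σ₀ * gD f 1 σ₀ = 0 := by
  -- abbreviations
  set z := toFn f (MvPolynomial.X 2) with hz
  set pp := gD f 0 z with hpp
  set qq := gD f 1 z with hqq
  set r := gD f 0 pp with hr
  set sm := gD f 1 pp with hsm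
  set tt := gD f 1 qq with htt
  -- symmetry of mixed derivatives
  have c1 : gD f 0 qq = sm := by rw [hqq, hsm, hpp, gD_comm h2 z]
  have c2 : gD f 0 sm = gD f 1 r := by rw [hsm, hr, gD_comm h2 pp]
  have c3 : gD f 0 tt = gD f 1 sm := by rw [htt, gD_comm h2 qq, c1]
  -- differentiate the two relations
  have hdisc' : sm * sm - r * tt = 0 := by rw [← sq]; exact hdisc
  have e0 := congrArg (gD f 0) hσ
  have e1 := congrArg (gD f 1) hσ
  have e3 := congrArg (gD f 1) hdisc'
  simp only [Derivation.leibniz, smul_eq_mul, map_neg, map_sub, map_zero] at e0 e1 e3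
  have key : tt ^ 3 * (gD f 0 σ₀ + σ₀ * gD f 1 σ₀) = 0 := by
    linear_combination (tt ^ 2) * e0 + (tt ^ 2 * σ₀) * e1 - (tt ^ 2) * c2 - (tt ^ 2 * σ₀) * c3 +
      (-2 * tt * gD f 1 sm - gD f 1 tt * (σ₀ * tt - sm)) * hσ + tt * e3 - gD f 1 tt * hdisc'
  exact (mul_eq_zero.1 key).resolve_left (pow_ne_zero 3 ht)

/-- **Case `t ≠ 0`, `s² = rt` (developable).** With `tσ₀ = -s`, the line through the generic
point with direction `(1, σ₀, p̄ + σ₀q̄)` lies on the surface. [cite: Kollar2015, Theorem 13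
and §6] -/
theorem aeval_line_eq_zero_of_developable (h2 : toFn f (MvPolynomial.pderiv 2 f) ≠ 0)
    (hfac : ∀ k, k ≤ f.totalDegree → ((k ! : ℕ) : K) ≠ 0)
    (ht : gD f 1 (gD f 1 (toFn f (MvPolynomial.X 2))) ≠ 0)
    (hdisc : gD f 1 (gD f 0 (toFn f (MvPolynomial.X 2))) ^ 2 -
      gD f 0 (gD f 0 (toFn f (MvPolynomial.X 2))) * gD f 1 (gD f 1 (toFn f (MvPolynomial.X 2)))
        = 0)
    (σ₀ : FnField f) (hσ : σ₀ * gD f 1 (gD f 1 (toFn f (MvPolynomial.X 2))) =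
      -gD f 1 (gD f 0 (toFn f (MvPolynomial.X 2)))) :
    MvPolynomial.aeval (fun i => C (toFn f (MvPolynomial.X i)) +
      C (![(1 : FnField f), σ₀, gD f 0 (toFn f (MvPolynomial.X 2)) +
        σ₀ * gD f 1 (toFn f (MvPolynomial.X 2))] i) * X) f = 0 := by
  have hslope := slope_const_of_developable h2 ht hdisc σ₀ hσ
  have hII : (1 : FnField f) ^ 2 * gD f 0 (gD f 0 (toFn f (MvPolynomial.X 2))) +
      2 * 1 * σ₀ * gD f 1 (gD f 0 (toFn f (MvPolynomial.X 2))) +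
      σ₀ ^ 2 * gD f 1 (gD f 1 (toFn f (MvPolynomial.X 2))) = 0 := by
    have key : gD f 1 (gD f 1 (toFn f (MvPolynomial.X 2))) *
        ((1 : FnField f) ^ 2 * gD f 0 (gD f 0 (toFn f (MvPolynomial.X 2))) +
          2 * 1 * σ₀ * gD f 1 (gD f 0 (toFn f (MvPolynomial.X 2))) +
          σ₀ ^ 2 * gD f 1 (gD f 1 (toFn f (MvPolynomial.X 2)))) = 0 := by
      linear_combination (σ₀ * gD f 1 (gD f 1 (toFn f (MvPolynomial.X 2))) +
        gD f 1 (gD f 0 (toFn f (MvPolynomial.X 2)))) * hσ - hdisc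
    exact (mul_eq_zero.1 key).resolve_left ht
  have key := aeval_line_eq_zero_of_II_eq_zero (L' := FnField f) h2 hfac
    (gD f 0 + σ₀ • gD f 1) 1 σ₀ (Derivation.map_one_eq_zero _)
    (by rw [Derivation.add_apply, Derivation.smul_apply, smul_eq_mul]; exact hslope)
    (fun u => by
      simp only [Algebra.algebraMap_self, RingHom.id_apply, Derivation.add_apply,
        Derivation.smul_apply, smul_eq_mul]
      ring)
    (by simp only [Algebra.algebraMap_self, RingHom.id_apply]; exact hII)
  simp only [Algebra.algebraMap_self, RingHom.id_apply, one_mul] at key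
  exact key

/-! ### Case `t ≠ 0`, `s² ≠ rt`, `T₂, T₃` not coprime (flecnodal) -/

/-- `T₂` is separable when `s² ≠ rt` and `2 ≠ 0`. [folklore] -/
theorem separable_osc_two (h2 : toFn f (MvPolynomial.pderiv 2 f) ≠ 0) (h2K : (2 : K) ≠ 0)
    (hdisc : gD f 1 (gD f 0 (toFn f (MvPolynomial.X 2))) ^ 2 -
      gD f 0 (gD f 0 (toFn f (MvPolynomial.X 2))) * gD f 1 (gD f 1 (toFn f (MvPolynomial.X 2)))
        ≠ 0) : (osc f 2).Separable := by
  rw [osc_two h2]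
  refine separable_quadratic ?_ hdisc
  intro h0
  apply h2K
  have : algebraMap K (FnField f) 2 = 0 := by rw [map_ofNat]; exact h0
  exact (algebraMap K (FnField f)).injective.eq_iff.1 (this.trans (map_zero _).symm)

/-- **Case `t ≠ 0`, `s² ≠ rt`, `T₂, T₃` not coprime (flecnodal).** There is `q ∈ L[σ]` of
positive degree such that, over `L' = L[σ]/(q) ∋ s`, the line through the generic point with
direction `(1, s, p̄ + s q̄)` lies on the surface. [cite: Kollar2015, Theorem 13 and §6] -/
theorem exists_flecnodal_line (h2 : toFn f (MvPolynomial.pderiv 2 f) ≠ 0)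
    (hfac : ∀ k, k ≤ f.totalDegree → ((k ! : ℕ) : K) ≠ 0) (h2K : (2 : K) ≠ 0)
    (ht : gD f 1 (gD f 1 (toFn f (MvPolynomial.X 2))) ≠ 0)
    (hdisc : gD f 1 (gD f 0 (toFn f (MvPolynomial.X 2))) ^ 2 -
      gD f 0 (gD f 0 (toFn f (MvPolynomial.X 2))) * gD f 1 (gD f 1 (toFn f (MvPolynomial.X 2)))
        ≠ 0)
    (hcop : ¬ IsCoprime (osc f 2) (osc f 3)) :
    ∃ q : Polynomial (FnField f), q.natDegree ≠ 0 ∧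
      MvPolynomial.aeval (fun i => C (algebraMap (FnField f) (AdjoinRoot q)
          (toFn f (MvPolynomial.X i))) +
        C (![(1 : AdjoinRoot q), AdjoinRoot.root q,
          1 * algebraMap (FnField f) (AdjoinRoot q) (gD f 0 (toFn f (MvPolynomial.X 2))) +
            AdjoinRoot.root q * algebraMap (FnField f) (AdjoinRoot q)
              (gD f 1 (toFn f (MvPolynomial.X 2)))] i) * X) f = 0 := by
  have hcoeff : (osc f 2).coeff 2 = gD f 1 (gD f 1 (toFn f (MvPolynomial.X 2))) := by
    rw [osc_two h2, coeff_add, coeff_add, coeff_C, coeff_C_mul_X, coeff_C_mul_X_pow]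
    simp
  have hT0 : osc f 2 ≠ 0 := fun h0 => ht (by rw [← hcoeff, h0, coeff_zero])
  obtain ⟨q, hqm, hqi, hq2, hq3⟩ := exists_monic_irreducible_dvd_of_not_isCoprime hT0 hcop
  haveI : Fact (Irreducible q) := ⟨hqi⟩
  haveI : Fact q.Monic := ⟨hqm⟩
  haveI : Fact q.Separable := ⟨(separable_osc_two h2 h2K hdisc).of_dvd hq2⟩
  have hnp := not_dvd_derivative_of_separable hqi hq2 (separable_osc_two h2 h2K hdisc)
  refine ⟨q, (natDegree_pos_iff_degree_pos.2 (degree_pos_of_irreducible hqi)).ne', ?_⟩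
  have hIIraw := aeval_osc_two h2 (A := AdjoinRoot q) (AdjoinRoot.root q)
  rw [AdjoinRoot.aeval_eq, AdjoinRoot.mk_eq_zero.2 hq2] at hIIraw
  exact aeval_line_eq_zero_of_II_eq_zero (L' := AdjoinRoot q) h2 hfac (Ds f q) 1
    (AdjoinRoot.root q) (Derivation.map_one_eq_zero _) (Ds_root_eq_zero f q hq2 hq3 hnp)
    (Ds_algebraMap f q) (by linear_combination -hIIraw)

end Hypersurface

end Literature.RingTheory.MvPolynomial
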